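import Literature.Topology.FourManifolds.CircleSurgeryExistence
import Literature.Topology.FourManifolds.ClosedBallProofs
import Literature.Topology.FourManifolds.NeckCapping
import HarnessLib

/-!
# Transporting a tubular neighbourhood of a circle along a diffeomorphism of open subsets

Generic four-manifold plumbing, written for the geometric core of R. Gompf, *More
Cappell–Shaneson spheres are standard*, Algebr. Geom. Topol. 10 (2010), Theorem 2.1 (bricks
`MappingTorusSliver.lean`, `CircleSurgeryLocal.lean`, `MappingTorusSliverSurgery.lean`): there a
tube `ν` of the section circle of a mapping torus `T` lies in the complement `U` of a fibre
sliver, and the sliver diffeomorphism `Θ : U ≅ U'` onto an open subset of another mapping torus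
`T'` is not globally defined, so `Literature.Topology.FourManifolds.CircleNbhd.map` (transport
along an ambient diffeomorphism, `GompfFramedSpheres.lean`) does not apply. This file supplies

* `Manifold.IsSmoothEmbedding.subtypeVal_comp` — a smooth embedding into an open submanifold
  `W ⊆ N` followed by the inclusion `W ↪ N` is a smooth embedding (postcomposition with the
  globally defined partial diffeomorphism `W.openPartialHomeomorphSubtypeCoe`);
* `Literature.Topology.FourManifolds.CircleNbhd.transportOpens ν hνU Θ` — **the transported tube
  `Θ ∘ ν`**, a tubular neighbourhood in `T'` of the transported circle `Θ ∘ c`, for a tube `ν` of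
  `c` with `range ν ⊆ U` and a diffeomorphism `Θ : U ≅ U'` of open subsets (Kosinski,
  *Differential Manifolds*, III.3: tubular neighbourhoods are transported by diffeomorphisms);
* the bookkeeping lemmas `transportOpens_apply`, `transportOpens_mem`,
  `mem_range_transportCurve_iff`.

No named facts are introduced; everything is proved.

## References

* A. Kosinski, *Differential Manifolds* (1993), Ch. III §3 (tubular neighbourhoods), Ch. VI §1.
  [Kosinski1993]
* R. E. Gompf, *More Cappell–Shaneson spheres are standard*, Algebr. Geom. Topol. 10 (2010)
  1665–1681, proof of Thm 2.1. [GompfAGT2010]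
-/

open scoped Manifold ContDiff Topology
open Set Function

noncomputable section

/-! ### Postcomposing a smooth embedding with the inclusion of an open submanifold -/

namespace Manifold

variable {EM HM : Type*} [NormedAddCommGroup EM] [NormedSpace ℝ EM] [TopologicalSpace HM]
  {I : ModelWithCorners ℝ EM HM} {M : Type*} [TopologicalSpace M] [ChartedSpace HM M]
  {EN : Type*} {HN : Type*} [NormedAddCommGroup EN] [NormedSpace ℝ EN] [TopologicalSpace HN]
  {J : ModelWithCorners ℝ EN HN} {N : Type*} [TopologicalSpace N] [ChartedSpace HN N]

/-- **A smooth embedding into an open submanifold, followed by the inclusion, is a smooth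
embedding** into the ambient manifold (the inclusion `W ↪ N` is a globally defined partial
diffeomorphism; postcomposition of immersions with such, `openPartialHomeomorph_comp`). Lee,
*Introduction to Smooth Manifolds* (2013), Ch. 5. [folklore] -/
theorem IsSmoothEmbedding.subtypeVal_comp [IsManifold I ∞ M] [IsManifold J ∞ N]
    (W : TopologicalSpace.Opens N) {f : M → ↥W} (hf : IsSmoothEmbedding I J ∞ f) :
    IsSmoothEmbedding I J ∞ (Subtype.val ∘ f) := by
  obtain ⟨⟨F, _, _, hF⟩, hemb⟩ := hf
  refine ⟨IsImmersionOfComplement.isImmersion (F := F) fun x ↦ ?_,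
    Topology.IsEmbedding.subtypeVal.comp hemb⟩
  have hne : Nonempty ↥W := ⟨f x⟩
  have h := (hF x).openPartialHomeomorph_comp (W.openPartialHomeomorphSubtypeCoe hne)
    (Literature.Topology.FourManifolds.contMDiffOn_openPartialHomeomorphSubtypeCoe W hne)
    (Literature.Topology.FourManifolds.contMDiffOn_openPartialHomeomorphSubtypeCoe_symm W hne)
    (by simp)
  rwa [TopologicalSpace.Opens.openPartialHomeomorphSubtypeCoe_coe] at h

end Manifold

namespace Literature.Topology.FourManifolds

universe u

/-- Local notation: `𝔼 n` is the model Euclidean space `EuclideanSpace ℝ (Fin n)`. -/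
local notation "𝔼 " n:arg => EuclideanSpace ℝ (Fin n)

/-- Local notation: `𝕊 n` is the unit sphere in `EuclideanSpace ℝ (Fin (n + 1))`. -/
local notation "𝕊 " n:arg => (Metric.sphere (0 : EuclideanSpace ℝ (Fin (n + 1))) 1)

attribute [local instance] fact_finrank_euclideanSpace_succ

/-! ### The transported tube -/

namespace CircleNbhd

variable {T : Type u} [TopologicalSpace T] [ChartedSpace (𝔼 4) T] [IsManifold (𝓡 4) ∞ T]
  {T' : Type u} [TopologicalSpace T'] [ChartedSpace (𝔼 4) T'] [IsManifold (𝓡 4) ∞ T']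
  {c : 𝕊 1 → T} (ν : CircleNbhd (𝓡 4) c)
  {U : TopologicalSpace.Opens T} {U' : TopologicalSpace.Opens T'}
  (hνU : ∀ q, ν.toFun q ∈ U) (Θ : ↥U ≃ₘ⟮𝓡 4, 𝓡 4⟯ ↥U')

/-- **The transported circle `Θ ∘ c`** (written through `ν (u, 0) = c u`, so that no transport of
membership proofs is needed). [folklore] -/
def transportCurve (u : 𝕊 1) : T' :=
  ((Θ ⟨ν.toFun (u, 0), hνU (u, 0)⟩ : ↥U') : T')

omit [IsManifold (𝓡 4) ∞ T] [IsManifold (𝓡 4) ∞ T'] in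
/-- The transported circle, pointwise. [folklore] -/
theorem transportCurve_apply (u : 𝕊 1) :
    transportCurve ν hνU Θ u = ((Θ ⟨ν.toFun (u, 0), hνU (u, 0)⟩ : ↥U') : T') := rfl

/-- **The transported tube `Θ ∘ ν`**: a tubular neighbourhood of the transported circle `Θ ∘ c`
in `T'`, for a tube `ν` of `c` in `T` contained in the open set `U` and a diffeomorphism
`Θ : U ≅ U'` onto an open subset of `T'` (Kosinski III.3; the ambient case is `CircleNbhd.map`). [cite: Kosinski1993, Ch. III §3 (tubular neighbourhoods under diffeomorphisms)] -/
def transportOpens : CircleNbhd (𝓡 4) (transportCurve ν hνU Θ) where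
  toFun q := ((Θ ⟨ν.toFun q, hνU q⟩ : ↥U') : T')
  isSmoothEmbedding := by
    have h1 : Manifold.IsSmoothEmbedding ((𝓡 1).prod 𝓘(ℝ, 𝔼 3)) (𝓡 4) ∞
        fun q : (𝕊 1) × (𝔼 3) ↦ (⟨ν.toFun q, hνU q⟩ : ↥U) :=
      ν.isSmoothEmbedding.codRestrict_opens U hνU
    exact (h1.diffeomorph_comp Θ).subtypeVal_comp U'
  isOpen_range := by
    have hr : range (fun q : (𝕊 1) × (𝔼 3) ↦ ((Θ ⟨ν.toFun q, hνU q⟩ : ↥U') : T')) =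
        Subtype.val '' (Θ '' (Subtype.val ⁻¹' range ν.toFun)) := by
      ext x'
      simp only [mem_range, mem_image, mem_preimage]
      constructor
      · rintro ⟨q, rfl⟩
        exact ⟨Θ ⟨ν.toFun q, hνU q⟩, ⟨⟨ν.toFun q, hνU q⟩, ⟨q, rfl⟩, rfl⟩, rfl⟩
      · rintro ⟨y', ⟨y, ⟨q, hq⟩, rfl⟩, rfl⟩
        refine ⟨q, ?_⟩
        have : (⟨ν.toFun q, hνU q⟩ : ↥U) = y := Subtype.ext hq
        rw [this]
    rw [hr]
    exact U'.2.isOpenMap_subtype_val _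
      (Θ.toHomeomorph.isOpenMap _ (ν.isOpen_range.preimage continuous_subtype_val))
  apply_zero u := rfl

/-- The transported tube, pointwise (definitional). [folklore] -/
@[simp] theorem transportOpens_apply (q : (𝕊 1) × (𝔼 3)) :
    (ν.transportOpens hνU Θ).toFun q = ((Θ ⟨ν.toFun q, hνU q⟩ : ↥U') : T') := rfl

/-- The transported tube lies in `U'`. [folklore] -/
theorem transportOpens_mem (q : (𝕊 1) × (𝔼 3)) : (ν.transportOpens hνU Θ).toFun q ∈ U' :=
  (Θ _).2

omit [IsManifold (𝓡 4) ∞ T] [IsManifold (𝓡 4) ∞ T'] in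
/-- **The transported circle is the image of the circle**: `x' ∈ range (Θ ∘ c)` iff
`x' = Θ x` for some `x ∈ U` on the circle `c`. [folklore] -/
theorem mem_range_transportCurve_iff {x' : T'} :
    x' ∈ range (transportCurve ν hνU Θ) ↔
      ∃ x : ↥U, (x : T) ∈ range c ∧ (Θ x : T') = x' := by
  constructor
  · rintro ⟨u, rfl⟩
    exact ⟨⟨ν.toFun (u, 0), hνU (u, 0)⟩, ⟨u, (ν.apply_zero u).symm⟩, rfl⟩
  · rintro ⟨x, ⟨u, hu⟩, rfl⟩
    refine ⟨u, ?_⟩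
    rw [transportCurve_apply]
    congr 2
    exact Subtype.ext ((ν.apply_zero u).trans hu)

omit [IsManifold (𝓡 4) ∞ T] [IsManifold (𝓡 4) ∞ T'] in
/-- Points of `U` off the circle go to points off the transported circle. [folklore] -/
theorem apply_not_mem_range_transportCurve {x : ↥U} (hx : (x : T) ∉ range c) :
    (Θ x : T') ∉ range (transportCurve ν hνU Θ) := by
  rw [mem_range_transportCurve_iff]
  rintro ⟨y, hy, hyx⟩
  have : y = x := Θ.injective (Subtype.ext hyx)
  exact hx (this ▸ hy)

end CircleNbhd

end Literature.Topology.FourManifolds
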